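import Summits.QuantumFields.YangMills.Theorems.UV3HTopConsumersT3
import HarnessLib

/-!
# `UV3BranchExpansionHTopT3EveryLevel` — THE hTop LETTERS BELOW THE TOP: `K`-FREE-SHAPE HAAR DOMINATION OF EVERY SEGMENT OF THE PINNED AVERAGING AND THE FLAT a.e.
# ENVELOPE OF THE PINNED MASSES AT EVERY LEVEL `k ≤ K`, FOR EVERY THREE-TORUS FAMILY, NO HYPOTHESIS — with the constant displayed as `#PBond(F.P K, level)·A_L`
# (print's `O(1)|T₁^{(k)}|` shape; crux `UnitScaleTilt.FluctuationComparisonRegPrIntL`, stmt-QuantumFields-20520, UP∘ road of px8 g15's LOCATE END→(5) (evidence #59), step (D1))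

Cell `ym3-torus` (YM ladder rung R3 = continuum SU(2) Yang–Mills on T³ — a RUNG, NOT the Clay problem: not d = 4, not infinite volume, not a mass gap); width seat
`ym3-torus-px20` (gen 12, width copy of `ym3-torus-p1`); helper `--supports stmt-QuantumFields-20520`.  THEOREMS ONLY (0 `def`, 0 `sorry`, default heartbeats).

WHY.  The 19936 lane's hTop series proves, for the PINNED block averaging `blockAvg ℰp` (`ℰp = expMeanLogSU` on `SU(2)`) of every three-torus family, segment by segment, that the
push-forward of product Haar is dominated by `exp(#PBond(target level)·A_L)·Haar` — `L = 3` ✓`UV3BranchExpansionHTopT3L3.map_iterFrom_blockAvg_le_exp_smul_L3` (px13∕w5),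
`4 ≤ L ≤ 20` ✓`UV3BranchExpansionHTopT3AllL.map_iterFrom_blockAvg_le_exp_smul_allL` (px13), `L ≥ 6` ✓`UV3BranchExpansionHTopT3EveryL.map_iterFrom_blockAvg_le_exp_smul_ge` (w8∕dag-n08-d) —
and merges the three ranges ONLY AT THE TOP LEVEL `j + n = K` (✓`topHaarPushforward_of_T3`, ✓`UV3HTopConsumersT3.massRecP_avT3_le_exp_ae_of_T3`).  The AC road to [Balaban1985UV3] Thm 1 (5)
upper for the pinned densities (px8 g15's LOCATE, 20520 evidence #59: AC (41) a.e. ⟹ Sect. D resummation ⟹ `Bounds5UpperAtHeight` ⟹ `HeightwiseUpperBound` = the persistence organ's UP∘)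
consumes the SAME letters AT EVERY LEVEL `k ≤ K` of the run-`K` lattice, `dU^{(K)}_k`-a.e., with the constant of the shape `O(1)·|T₁^{(k)}|` — the «RISK named in advance» of that LOCATE.
THIS FILE supplies them, hypothesis-free, by the same three-way case split on `F.L` (odd and `> 1`, so `L = 3 ∨ 4 ≤ L ≤ 20 ∨ 21 ≤ L`):
* §1 ★★`map_iterFrom_blockAvg_le_exp_smul_of_T3 (F) : ∃ A ≥ 0, ∀ K j n, j + n ≤ F.m + K → (dU^{(K)}_j).map (iterFrom (blockAvg ℰp) j n) ≤ ofReal (exp (#PBond(F.P K, j+n)·A)) • dU^{(K)}_{j+n}`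
  — EVERY SEGMENT of the standing range, ONE `A = A(F.L)`; ★★`map_iterFrom_avT3_le_exp_smul_of_T3` — the same for the lane's family `avT3 F K` (✓`iterFrom_avT3_eq_iterFrom_blockAvg`).
* §2 ★★★`massRecP_avT3_le_exp_ae_of_level (F) : ∃ A ≥ 0, ∀ K k, k ≤ F.m + K → ∀ M₁ Rcol εL εS (r : Hist (F.P K) k), ∀ᵐ W ∂dU^{(K)}_k, massRecP M₁ Rcol εL εS (avT3 F K) k r W ≤
  exp (#PBond(F.P K, k)·A)` — w8's ✓p766572 flat envelope of the pinned masses of (41) AT EVERY LEVEL (the generic door ✓`UV3StartClosedOfTopHaarPushforward.massRecP_le_exp_ae_of_map_iterFrom_le_top`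
  is already generic in its target level; §1 feeds it at `j + n = k`).
  ★★`massP_le_exp_ae_of_level` — the same in the v3 package currency `PinnedStep.massP 𝔠.lane p.X k r` (px8 g15's (O-UP) FILE 1 §3 shape; `p.X.av = avT3 F K` definitional).
* §3 consistency: at `k = K` §2 re-gives ✓`massRecP_avT3_le_exp_ae_of_T3`'s letter with the displayed constant (`#PBond(F.P K, K)` is `K`-free, ✓`card_pBond_top`).
HONEST SCOPE.  Merges and re-instantiations of landed theorems; no new analysis; nothing of (5)∕(41)∕(47)∕the (α) rows∕UP∘∕PERS₁∘∕20520∕19936 is proved; `YM3TorusSU2` NOT proved; the Yang–Mills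
mass gap is NOT proved.  HYP-SAT (№42): hypothesis-free beyond `F` and the standing range `j + n ≤ F.m + K` ∕ `k ≤ F.m + K` (every level a run uses).
References: [Balaban1985UV3] = T. Bałaban, CMP 102 (1985) 255–275 ((2) p.256, (5) p.256–257, (41) p.266, (48) p.268); [Balaban1985Averaging] = CMP 98 (1985) 17–51 ((10), (15) p.19);
[Balaban1987RG1] = CMP 109 (1987) 249–301 ((0.4), (0.11) p.253).
-/

noncomputable section

set_option autoImplicit false

namespace Summit.QuantumFields.YangMills.Theorems.UV3BranchExpansionHTopT3EveryLevel

open MeasureTheory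
open scoped ENNReal
open Literature.MathematicalPhysics.QuantumFieldTheory.Balaban1983to89
open Literature.MathematicalPhysics.QuantumFieldTheory.Balaban1983to89.T3ContinuumYM3Torus
open Literature.MathematicalPhysics.QuantumFieldTheory.Balaban1983to89.T3UnitLawDensityEML (ℰp)
open Literature.MathematicalPhysics.QuantumFieldTheory.Balaban1983to89.BlockAveraging (blockAvg)
open Literature.MathematicalPhysics.QuantumFieldTheory.Balaban1983to89.T4AvgSensitivity (iterFrom)
open Literature.MathematicalPhysics.QuantumFieldTheory.Balaban1985CMP102
open Literature.MathematicalPhysics.QuantumFieldTheory.Balaban1985CMP102.Setting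
open Summit.QuantumFields.Balaban3D.Carriers
open Summit.QuantumFields.Balaban3D.Proofs.Primitives
open Summit.QuantumFields.Balaban3D.Proofs.GroupModelLieC
open Summit.QuantumFields.Balaban3D.Proofs.StandardAC
open Summit.QuantumFields.Balaban3D.Proofs.InputsAC
open Summit.QuantumFields.Balaban3D.Proofs.MassesPAC
open Summit.QuantumFields.YangMills.Theorems.UV3BranchExpansionCountingSmallness (M_pos)
open Summit.QuantumFields.YangMills.Theorems.UV3BranchExpansionCountingSmallnessT3 (theta_allL_lt_one)
open Summit.QuantumFields.YangMills.Theorems.UV3BranchExpansionHTopT3L3 (map_iterFrom_blockAvg_le_exp_smul_L3 card_pBond_top)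
open Summit.QuantumFields.YangMills.Theorems.UV3BranchExpansionHTopT3AllL (map_iterFrom_blockAvg_le_exp_smul_allL)
open Summit.QuantumFields.YangMills.Theorems.UV3BranchExpansionHTopT3EveryL (map_iterFrom_blockAvg_le_exp_smul_ge)
open Summit.QuantumFields.YangMills.Theorems.UV3PinnedStepOrganOfTopPartialIterates (iterFrom_avT3_eq_iterFrom_blockAvg)
open Summit.QuantumFields.YangMills.Theorems.UV3StartClosedOfTopHaarPushforward (massRecP_le_exp_ae_of_map_iterFrom_le_top)

/-! ## §1 Every segment of the standing range, every block size: one constant `A(L)` times the target-level bond count -/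

/-- ★★ **HAAR DOMINATION OF EVERY SEGMENT OF THE PINNED AVERAGING, EVERY THREE-TORUS FAMILY, NO HYPOTHESIS**: there is `A = A(F.L) ≥ 0` such that for every run
lattice `F.P K` and every segment `j → j + n` of the standing range (`j + n ≤ F.m + K`), `(dU^{(K)}_j).map (iterFrom (blockAvg ℰp) j n) ≤ exp(#PBond(F.P K, j+n)·A) • dU^{(K)}_{j+n}`.
Three-way merge of ✓`map_iterFrom_blockAvg_le_exp_smul_L3` (`L = 3`), ✓`…_allL` (`4 ≤ L ≤ 20`), ✓`…_ge` (`L ≥ 6`, used for `L ≥ 21`); `L` is odd and `> 1` (`T3Family.hL`).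
[cite: Balaban1987RG1, (0.4) p.253; Balaban1985UV3, (2) p.256; Balaban1985Averaging, (10) p.19] -/
theorem map_iterFrom_blockAvg_le_exp_smul_of_T3 (F : T3Family) :
    ∃ A : ℝ, 0 ≤ A ∧ ∀ (K j n : ℕ), j + n ≤ F.m + K →
      (fieldMeasure (F.P K) j (Matrix.specialUnitaryGroup (Fin 2) ℂ)).map
          (iterFrom (fun i => blockAvg (P := F.P K) (G := Matrix.specialUnitaryGroup (Fin 2) ℂ) (j := i) ℰp) j n) ≤
        ENNReal.ofReal (Real.exp (Fintype.card (PBond (F.P K) (j + n)) * A)) •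
          fieldMeasure (F.P K) (j + n) (Matrix.specialUnitaryGroup (Fin 2) ℂ) := by
  obtain ⟨hodd, h1⟩ := F.hL
  have h2 : F.L ≠ 2 := fun h => by
    rw [h] at hodd
    exact (Nat.not_odd_iff_even.2 (by decide)) hodd
  by_cases h3 : F.L = 3
  · exact ⟨2 / (1 - 17 / 20) * (3 / 100000 / (9 / 10 : ℝ) ^ 10), by positivity,
      fun K j n hjn => map_iterFrom_blockAvg_le_exp_smul_L3 F h3 K j n hjn⟩
  have h4 : 4 ≤ F.L := by omega
  have hθ₀ : (1 + (9 / 10 : ℝ) ^ (F.L - 1)) / 2 < 1 := theta_allL_lt_one h4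
  by_cases h20 : F.L ≤ 20
  · exact ⟨2 / (1 - (1 + (9 / 10 : ℝ) ^ (F.L - 1)) / 2) * (1 / 10 ^ 14 / (9 / 10 : ℝ) ^ ((2 * 3 - 1) * (F.L - 1))),
      mul_nonneg (M_pos hθ₀).le (by positivity),
      fun K j n hjn => map_iterFrom_blockAvg_le_exp_smul_allL F h4 h20 K j n hjn⟩
  · exact ⟨2 / (1 - (1 + (9 / 10 : ℝ) ^ (F.L - 1)) / 2) *
        ((9 / 10 : ℝ) ^ ((2 * 3 - 1) * (F.L - 1)) / (10 ^ 4 * (F.L : ℝ) ^ 4) / (9 / 10 : ℝ) ^ ((2 * 3 - 1) * (F.L - 1))),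
      mul_nonneg (M_pos hθ₀).le (by positivity),
      fun K j n hjn => map_iterFrom_blockAvg_le_exp_smul_ge F (by omega) K j n hjn⟩

/-- ★★ **THE SAME FOR THE LANE'S PINNED FAMILY `avT3 F K`** (`= blockAvg ℰp` in the standing range, ✓`iterFrom_avT3_eq_iterFrom_blockAvg`): every segment, every `L`, no hypothesis.
[cite: Balaban1987RG1, (0.4)+(0.11) p.253; Balaban1985UV3, (2) p.256] -/
theorem map_iterFrom_avT3_le_exp_smul_of_T3 (F : T3Family) :
    ∃ A : ℝ, 0 ≤ A ∧ ∀ (K j n : ℕ), j + n ≤ F.m + K →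
      (fieldMeasure (F.P K) j (Matrix.specialUnitaryGroup (Fin 2) ℂ)).map (iterFrom (avT3 F K) j n) ≤
        ENNReal.ofReal (Real.exp (Fintype.card (PBond (F.P K) (j + n)) * A)) •
          fieldMeasure (F.P K) (j + n) (Matrix.specialUnitaryGroup (Fin 2) ℂ) := by
  obtain ⟨A, hA0, hA⟩ := map_iterFrom_blockAvg_le_exp_smul_of_T3 F
  refine ⟨A, hA0, fun K j n hjn => ?_⟩
  rw [iterFrom_avT3_eq_iterFrom_blockAvg F K j n hjn]
  exact hA K j n hjn

/-! ## §2 The flat a.e. envelope of the pinned masses of (41) at EVERY level -/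

/-- ★★★ **THE PINNED MASSES OF (41) ARE FLATLY BOUNDED a.e. AT EVERY LEVEL `k ≤ F.m + K`, EVERY HISTORY, ALL CARRIER PARAMETERS, EVERY THREE-TORUS FAMILY — NO HYPOTHESIS**:
`∃ A = A(F.L) ≥ 0, ∀ K k ≤ F.m + K, ∀ M₁ Rcol εL εS (r : Hist (F.P K) k), massRecP M₁ Rcol εL εS (avT3 F K) k r W ≤ exp(#PBond(F.P K, k)·A)` for `dU^{(K)}_k`-a.e. `W`.  The generic door
✓`massRecP_le_exp_ae_of_map_iterFrom_le_top` (pub-ymgap dag-n08-d ∕ px8) at target level `Kt := k`, fed by §1 on the segments `j + n = k`; at `k = K` this is w8's ✓p766572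
`massRecP_avT3_le_exp_ae_of_T3` with the constant displayed.  Print's shape `exp(O(1)|T₁^{(k)}|)` for the Sect. D resummation of (41) at level `k`.
[cite: Balaban1985UV3, (41) p.266 + (48) p.268 + (2) p.256; Balaban1985Averaging, (15) p.19; Balaban1987RG1, (0.11) p.253] -/
theorem massRecP_avT3_le_exp_ae_of_level (F : T3Family) :
    ∃ A : ℝ, 0 ≤ A ∧ ∀ (K k : ℕ), k ≤ F.m + K → ∀ (M₁ : ℕ) (Rcol : ℕ → ℕ) (εL εS : ℕ → ℝ) (r : Hist (F.P K) k),
      ∀ᵐ W ∂(fieldMeasure (F.P K) k (Matrix.specialUnitaryGroup (Fin 2) ℂ)),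
        massRecP M₁ Rcol εL εS (avT3 F K) k r W ≤ Real.exp (Fintype.card (PBond (F.P K) k) * A) := by
  obtain ⟨A, hA0, hA⟩ := map_iterFrom_avT3_le_exp_smul_of_T3 F
  refine ⟨A, hA0, fun K k hk M₁ Rcol εL εS r => ?_⟩
  refine massRecP_le_exp_ae_of_map_iterFrom_le_top (avT3 F K) (avgAC_avT3 F K) M₁ Rcol εL εS k
    (Fintype.card (PBond (F.P K) k) * A) (by positivity) (fun j n hjn => ?_) r
  subst hjn
  exact hA K j n hk

/-- ★★ **THE SAME IN THE v3 PACKAGE CURRENCY** (px8 g15's (O-UP) FILE 1 §3 shape): for every v3 package `p : AlphaInputsT3AC.PkgAtV3 F 𝔠 γ hγ hγ1 K` the lane's pinned masses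
`PinnedStep.massP 𝔠.lane p.X k r` (= `massRecP` at the lane's carrier parameters along `p.X.av = avT3 F K`, definitional) are `≤ exp(#PBond(F.P K, k)·A)` `dU^{(K)}_k`-a.e. at
EVERY level `k ≤ F.m + K`, every history — the level-`k` twin of ✓`UV3PinnedMassEnvelopeV3OfN08.massP_le_exp_ae_of_startClosed` with NO `hN08` letter (hTop is a theorem).
[cite: Balaban1985UV3, (41) p.266 + (48) p.268 + (2) p.256; Balaban1987RG1, (0.11) p.253] -/
theorem massP_le_exp_ae_of_level (F : T3Family) :
    ∃ A : ℝ, 0 ≤ A ∧ ∀ (𝔠 : AlphaConsts F.L (suGroupModel 2).N) (γ : ℝ) (hγ : 0 < γ) (hγ1 : γ ≤ (min 𝔠.gamma0 1) ^ 2) (K : ℕ)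
      (p : AlphaInputsT3AC.PkgAtV3 F 𝔠 γ hγ hγ1 K) (k : ℕ), k ≤ F.m + K → ∀ (r : Hist (F.P K) k),
        ∀ᵐ W ∂(fieldMeasure (F.P K) k (Matrix.specialUnitaryGroup (Fin 2) ℂ)),
          PinnedStep.massP 𝔠.lane p.X k r W ≤ Real.exp (Fintype.card (PBond (F.P K) k) * A) := by
  obtain ⟨A, hA0, hA⟩ := massRecP_avT3_le_exp_ae_of_level F
  exact ⟨A, hA0, fun 𝔠 γ hγ hγ1 K p k hk r => hA K k hk _ _ _ _ r⟩

/-! ## §3 Consistency at the top -/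

/-- ★ At the top level `k = K` the envelope of §2 is w8's ✓`massRecP_avT3_le_exp_ae_of_T3` letter with the displayed, `K`-FREE constant `exp(#PBond(F.P K, K)·A) =
exp((2·L^m)³·3·A)` (✓`card_pBond_top`). [cite: Balaban1985UV3, (41) p.266 + (2) p.256] -/
theorem massRecP_avT3_le_exp_ae_top_displayed (F : T3Family) :
    ∃ A : ℝ, 0 ≤ A ∧ ∀ (K : ℕ) (M₁ : ℕ) (Rcol : ℕ → ℕ) (εL εS : ℕ → ℝ) (r : Hist (F.P K) K),
      ∀ᵐ W ∂(fieldMeasure (F.P K) K (Matrix.specialUnitaryGroup (Fin 2) ℂ)),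
        massRecP M₁ Rcol εL εS (avT3 F K) K r W ≤ Real.exp (((2 * F.L ^ F.m) ^ 3 * 3 : ℕ) * A) := by
  obtain ⟨A, hA0, hA⟩ := massRecP_avT3_le_exp_ae_of_level F
  refine ⟨A, hA0, fun K M₁ Rcol εL εS r => ?_⟩
  have h := hA K K (by omega) M₁ Rcol εL εS r
  rw [card_pBond_top] at h
  exact h

end Summit.QuantumFields.YangMills.Theorems.UV3BranchExpansionHTopT3EveryLevel

end
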